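import Literature.Probability.RandomPlanarGeometry.SLESlopeFunctionals
import HarnessLib

/-!
# A bounded solution of `A U = -2 g_ℓ` for the SLE slope generator (occupation of high levels)

Topic `Probability/RandomPlanarGeometry`; real analysis only (no probability). For the generator
`A F = (κ/2) F'' + (4w/(1+w²)) F'` of the SLE_κ slope diffusion `wₜ = xₜ/yₜ` (`slopeGen`,
`SLESlopeFunctionals.lean`; Rohde–Schramm (2005), proof of Lemma 6.3) and a level `ℓ > 0` we
construct an **even function `U_ℓ ∈ C²(ℝ)` with**

  `A U_ℓ = -2 g_ℓ`,  `0 ≤ U_ℓ ≤ Ū_ℓ`,  `Ū_ℓ ≤ C_κ / ℓ²` (`ℓ ≥ 2`, `0 < κ < 8`),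

where `g_ℓ(w) = f(w) φ_ℓ(|w|)`, `f(w) = 4/(1+w²)²` is the rate `d(log ψ)/du` of Rohde–Schramm's
ratio in the clock `du = dt/y²` (`loewnerLogDerivRate x y = y⁻² f(x/y)`,
`loewnerLogDerivRate_eq_slopeRate`) and `φ_ℓ` is the continuous ramp `0` on `[0, ℓ/2]`, `1` on
`[ℓ, ∞)`. Explicitly, with the integrating factor `(1+w²)^{4/κ}` of `A`
(`A = (κ/2)(1+w²)^{-4/κ} ∂[(1+w²)^{4/κ} ∂]`):

  `G(w) = ∫₀ʷ g_ℓ(v)(1+v²)^{4/κ} dv`,  `k(r) = (1+r²)^{-4/κ} G(r)`,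
  `U_ℓ(w) = Ū_ℓ - (4/κ) ∫₀ʷ k`,  `Ū_ℓ = (4/κ) ∫₀^∞ k`.

The decay `Ū_ℓ ≤ C_κ/ℓ²` (`occSup_le`, `C_κ = 64/κ + 64/(8-κ)`, two regimes `κ ≤ 4`, `κ > 4`) is the
Green's-function estimate "the expected `u`-time the transient slope diffusion spends accumulating
`log ψ` at heights `|w| ≳ ℓ` is `O(ℓ²) · O(ℓ⁻⁴)`". With `μ_ℓ = ℓ²/C_κ` the function `V = 1 + μ_ℓ U_ℓ`
satisfies `1 ≤ V ≤ 2` and `(A + μ_ℓ g_ℓ) V ≤ 0`, which makes `V(wₜ) exp(μ_ℓ ∫ g_ℓ(w)/y²)` a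
supermartingale (`SLESlopeOccupation.lean`): the exponential tail of the occupation functionals
in the proof of the sharp one-point upper estimate (Beffara (2008), Prop. 4, upper half).

## References

* S. Rohde, O. Schramm, *Basic properties of SLE*, Ann. of Math. 161 (2005), proof of Lemma 6.3
  (the diffusion `w(u)`, eq. (6.9)).
* V. Beffara, *The dimension of the SLE curves*, Ann. Probab. 36 (2008), Prop. 4.
* D. Revuz, M. Yor, *Continuous Martingales and Brownian Motion* (1999), Ch. VII, §3 (scale
  function and Green's function of a one-dimensional diffusion).
-/

noncomputable section

open Set Filter MeasureTheory intervalIntegral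
open _root_.Topology
open scoped NNReal

namespace Literature.Probability.RandomPlanarGeometry

/-! ### The rate `f(w) = 4/(1+w²)²`, the ramp and the band rate `g_ℓ` -/

section Rates

/-- **The rate `f(w) = 4/(1+w²)²`** of `log ψ` in the clock `du = dt/y²`:
`∂ₜ log ψₜ = 4yₜ²/|zₜ|⁴ = yₜ⁻² f(wₜ)`. [cite: RohdeSchramm2005, Lemma 6.3 (proof)] -/
def slopeRate (w : ℝ) : ℝ := 4 / (1 + w ^ 2) ^ 2

/-- Unfolding lemma for `slopeRate`. [folklore] -/
theorem slopeRate_apply (w : ℝ) : slopeRate w = 4 / (1 + w ^ 2) ^ 2 := rfl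

/-- `f > 0`. [folklore] -/
theorem slopeRate_pos (w : ℝ) : 0 < slopeRate w := by
  rw [slopeRate_apply]; positivity

/-- `f ≥ 0`. [folklore] -/
theorem slopeRate_nonneg (w : ℝ) : 0 ≤ slopeRate w := (slopeRate_pos w).le

/-- `f ≤ 4`. [folklore] -/
theorem slopeRate_le_four (w : ℝ) : slopeRate w ≤ 4 := by
  rw [slopeRate_apply, div_le_iff₀ (by positivity)]
  nlinarith [sq_nonneg w, sq_nonneg (w ^ 2)]

/-- `f` is even. [folklore] -/
theorem slopeRate_neg (w : ℝ) : slopeRate (-w) = slopeRate w := by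
  simp [slopeRate_apply]

/-- `f` is continuous. [folklore] -/
theorem continuous_slopeRate : Continuous slopeRate := by
  unfold slopeRate
  exact continuous_const.div ((continuous_const.add (continuous_id.pow 2)).pow 2)
    fun w ↦ by positivity

/-- `f` is smooth. [folklore] -/
theorem contDiff_slopeRate {n : WithTop ℕ∞} : ContDiff ℝ n slopeRate := by
  unfold slopeRate
  exact contDiff_const.div ((contDiff_const.add (contDiff_id.pow 2)).pow 2) fun w ↦ by positivity

/-- **`4y²/(x²+y²)² = y⁻² f(x/y)`**: the rate of `log ψ` along the centred flow is `y⁻²` times the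
rate in the slope variable. [cite: RohdeSchramm2005, Lemma 6.3 (proof)] -/
theorem loewnerLogDerivRate_eq_slopeRate {x y : ℝ} (hy : y ≠ 0) :
    loewnerLogDerivRate x y = (y⁻¹) ^ 2 * slopeRate (x * y⁻¹) := by
  obtain ⟨w, rfl⟩ : ∃ w, x = w * y := ⟨x * y⁻¹, by field_simp⟩
  have hw : w * y * y⁻¹ = w := mul_inv_cancel_right₀ hy w
  rw [hw, loewnerLogDerivRate_apply, slopeRate_apply]
  have h1 : (w * y) ^ 2 + y ^ 2 = y ^ 2 * (1 + w ^ 2) := by ring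
  have hpos : (0 : ℝ) < 1 + w ^ 2 := by positivity
  rw [h1]
  field_simp

/-- **The ramp `φ_ℓ`**: continuous, `0` on `(-∞, ℓ/2]`, `1` on `[ℓ, ∞)`, linear in between.
[folklore] -/
def levelRamp (ℓ x : ℝ) : ℝ := min 1 (max 0 (2 * x / ℓ - 1))

/-- Unfolding lemma for `levelRamp`. [folklore] -/
theorem levelRamp_apply (ℓ x : ℝ) : levelRamp ℓ x = min 1 (max 0 (2 * x / ℓ - 1)) := rfl

/-- `0 ≤ φ`. [folklore] -/
theorem levelRamp_nonneg (ℓ x : ℝ) : 0 ≤ levelRamp ℓ x :=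
  le_min zero_le_one (le_max_left _ _)

/-- `φ ≤ 1`. [folklore] -/
theorem levelRamp_le_one (ℓ x : ℝ) : levelRamp ℓ x ≤ 1 := min_le_left _ _

/-- `φ = 1` on `[ℓ, ∞)` (`ℓ > 0`). [folklore] -/
theorem levelRamp_eq_one {ℓ x : ℝ} (hℓ : 0 < ℓ) (hx : ℓ ≤ x) : levelRamp ℓ x = 1 := by
  rw [levelRamp_apply]
  refine min_eq_left (le_max_of_le_right ?_)
  rw [le_sub_iff_add_le, le_div_iff₀ hℓ]
  linarith

/-- `φ = 0` on `(-∞, ℓ/2]` (`ℓ > 0`). [folklore] -/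
theorem levelRamp_eq_zero {ℓ x : ℝ} (hℓ : 0 < ℓ) (hx : x ≤ ℓ / 2) : levelRamp ℓ x = 0 := by
  rw [levelRamp_apply]
  have : 2 * x / ℓ - 1 ≤ 0 := by
    rw [sub_nonpos, div_le_iff₀ hℓ]
    linarith
  rw [max_eq_left this, min_eq_right zero_le_one]

/-- `φ_ℓ` is continuous. [folklore] -/
theorem continuous_levelRamp (ℓ : ℝ) : Continuous (levelRamp ℓ) := by
  unfold levelRamp
  exact continuous_const.min (continuous_const.max
    (((continuous_const.mul continuous_id).div_const ℓ).sub continuous_const))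

/-- **The band rate `g_ℓ(w) = f(w) φ_ℓ(|w|)`**: continuous, even, `0 ≤ g_ℓ ≤ f`, equal to `f` for
`|w| ≥ ℓ` and to `0` for `|w| ≤ ℓ/2`. [folklore] -/
def bandRate (ℓ w : ℝ) : ℝ := slopeRate w * levelRamp ℓ |w|

/-- Unfolding lemma for `bandRate`. [folklore] -/
theorem bandRate_apply (ℓ w : ℝ) : bandRate ℓ w = slopeRate w * levelRamp ℓ |w| := rfl

/-- `g ≥ 0`. [folklore] -/
theorem bandRate_nonneg (ℓ w : ℝ) : 0 ≤ bandRate ℓ w :=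
  mul_nonneg (slopeRate_nonneg w) (levelRamp_nonneg ℓ _)

/-- `g ≤ f`. [folklore] -/
theorem bandRate_le_slopeRate (ℓ w : ℝ) : bandRate ℓ w ≤ slopeRate w := by
  rw [bandRate_apply]
  exact mul_le_of_le_one_right (slopeRate_nonneg w) (levelRamp_le_one ℓ _)

/-- `g ≤ 4`. [folklore] -/
theorem bandRate_le_four (ℓ w : ℝ) : bandRate ℓ w ≤ 4 :=
  (bandRate_le_slopeRate ℓ w).trans (slopeRate_le_four w)

/-- `g = f` for `|w| ≥ ℓ`. [folklore] -/
theorem bandRate_eq_slopeRate {ℓ w : ℝ} (hℓ : 0 < ℓ) (hw : ℓ ≤ |w|) : bandRate ℓ w = slopeRate w := by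
  rw [bandRate_apply, levelRamp_eq_one hℓ hw, mul_one]

/-- `g = 0` for `|w| ≤ ℓ/2`. [folklore] -/
theorem bandRate_eq_zero {ℓ w : ℝ} (hℓ : 0 < ℓ) (hw : |w| ≤ ℓ / 2) : bandRate ℓ w = 0 := by
  rw [bandRate_apply, levelRamp_eq_zero hℓ hw, mul_zero]

/-- `g` is even. [folklore] -/
theorem bandRate_neg (ℓ w : ℝ) : bandRate ℓ (-w) = bandRate ℓ w := by
  rw [bandRate_apply, bandRate_apply, slopeRate_neg, abs_neg]

/-- `g_ℓ` is continuous. [folklore] -/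
theorem continuous_bandRate (ℓ : ℝ) : Continuous (bandRate ℓ) :=
  continuous_slopeRate.mul ((continuous_levelRamp ℓ).comp continuous_abs)

end Rates

/-! ### The integrating factor, `G`, `k` -/

section Kernel

variable (κ : ℝ≥0) (ℓ : ℝ)

/-- The weighted band rate `g̃(v) = g_ℓ(v) (1+v²)^{4/κ}`. [folklore] -/
def bandRateW (v : ℝ) : ℝ := bandRate ℓ v * (1 + v ^ 2) ^ ((4 : ℝ) / κ)

/-- `G(w) = ∫₀ʷ g̃` (an odd `C¹` function). [folklore] -/
def bandPrim (w : ℝ) : ℝ := ∫ v in (0 : ℝ)..w, bandRateW κ ℓ v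

/-- `k(r) = (1+r²)^{-4/κ} G(r)` (odd, `C¹`, `≥ 0` on `[0, ∞)`): `-(κ/4) U'`. [folklore] -/
def occKernel (r : ℝ) : ℝ := (1 + r ^ 2) ^ (-(4 : ℝ) / κ) * bandPrim κ ℓ r

/-- The derivative of `k`: `k' = -(8r/(κ(1+r²))) k + g_ℓ`. [folklore] -/
def occKernelDeriv (r : ℝ) : ℝ := -(8 * r / ((κ : ℝ) * (1 + r ^ 2))) * occKernel κ ℓ r + bandRate ℓ r

variable {κ ℓ}

/-- `1 + v² > 0`. [folklore] -/
theorem one_add_sq_pos_slope (v : ℝ) : (0 : ℝ) < 1 + v ^ 2 := by positivity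

/-- `g̃ ≥ 0`. [folklore] -/
theorem bandRateW_nonneg (v : ℝ) : 0 ≤ bandRateW κ ℓ v :=
  mul_nonneg (bandRate_nonneg ℓ v) (Real.rpow_nonneg (one_add_sq_pos_slope v).le _)

/-- `g̃` is even. [folklore] -/
theorem bandRateW_neg (v : ℝ) : bandRateW κ ℓ (-v) = bandRateW κ ℓ v := by
  rw [bandRateW, bandRateW, bandRate_neg, neg_sq]

/-- `g̃` vanishes on `|v| ≤ ℓ/2` (`ℓ > 0`). [folklore] -/
theorem bandRateW_eq_zero (hℓ : 0 < ℓ) {v : ℝ} (hv : |v| ≤ ℓ / 2) : bandRateW κ ℓ v = 0 := by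
  rw [bandRateW, bandRate_eq_zero hℓ hv, zero_mul]

/-- `g̃ ≤ 4 (1+v²)^{4/κ-2}`. [folklore] -/
theorem bandRateW_le (v : ℝ) : bandRateW κ ℓ v ≤ 4 * (1 + v ^ 2) ^ ((4 : ℝ) / κ - 2) := by
  rw [bandRateW, Real.rpow_sub (one_add_sq_pos_slope v), Real.rpow_two, mul_div_assoc']
  rw [le_div_iff₀ (by positivity)]
  calc bandRate ℓ v * (1 + v ^ 2) ^ ((4 : ℝ) / κ) * (1 + v ^ 2) ^ 2
      = bandRate ℓ v * (1 + v ^ 2) ^ 2 * (1 + v ^ 2) ^ ((4 : ℝ) / κ) := by ring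
    _ ≤ 4 * (1 + v ^ 2) ^ ((4 : ℝ) / κ) := by
        refine mul_le_mul_of_nonneg_right ?_ (Real.rpow_nonneg (one_add_sq_pos_slope v).le _)
        calc bandRate ℓ v * (1 + v ^ 2) ^ 2 ≤ slopeRate v * (1 + v ^ 2) ^ 2 :=
              mul_le_mul_of_nonneg_right (bandRate_le_slopeRate ℓ v) (by positivity)
          _ = 4 := by rw [slopeRate_apply]; field_simp

/-- `g̃` is continuous. [folklore] -/
theorem continuous_bandRateW : Continuous (bandRateW κ ℓ) :=
  (continuous_bandRate ℓ).mul ((continuous_const.add (continuous_id.pow 2)).rpow_const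
    fun v ↦ Or.inl (one_add_sq_pos_slope v).ne')

/-- **`G' = g̃`** (fundamental theorem of calculus). [folklore] -/
theorem hasDerivAt_bandPrim (w : ℝ) : HasDerivAt (bandPrim κ ℓ) (bandRateW κ ℓ w) w :=
  (continuous_bandRateW.integral_hasStrictDerivAt 0 w).hasDerivAt

/-- `G` is continuous. [folklore] -/
theorem continuous_bandPrim : Continuous (bandPrim κ ℓ) :=
  continuous_iff_continuousAt.2 fun w ↦ (hasDerivAt_bandPrim w).continuousAt

/-- `G` is odd. [folklore] -/
theorem bandPrim_neg (w : ℝ) : bandPrim κ ℓ (-w) = -bandPrim κ ℓ w := by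
  rw [bandPrim, bandPrim]
  have h1 : (∫ v in (0 : ℝ)..-w, bandRateW κ ℓ v) = ∫ v in (0 : ℝ)..-w, bandRateW κ ℓ (-v) := by
    refine integral_congr fun v _ ↦ ?_
    exact (bandRateW_neg v).symm
  rw [h1, intervalIntegral.integral_comp_neg, neg_neg, neg_zero, integral_symm]

/-- `G ≥ 0` on `[0, ∞)`. [folklore] -/
theorem bandPrim_nonneg {w : ℝ} (hw : 0 ≤ w) : 0 ≤ bandPrim κ ℓ w :=
  intervalIntegral.integral_nonneg hw fun v _ ↦ bandRateW_nonneg v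

/-- `G = 0` on `[0, ℓ/2]` (`ℓ > 0`). [folklore] -/
theorem bandPrim_eq_zero (hℓ : 0 < ℓ) {w : ℝ} (hw0 : 0 ≤ w) (hw : w ≤ ℓ / 2) : bandPrim κ ℓ w = 0 := by
  rw [bandPrim]
  refine intervalIntegral.integral_zero_ae (ae_of_all _ fun v hv ↦ ?_)
  rw [uIoc_of_le hw0] at hv
  exact bandRateW_eq_zero hℓ (by rw [abs_of_pos hv.1]; exact hv.2.trans hw)

/-- `G(r) = ∫_{ℓ/2}^r g̃` (`ℓ > 0`; `G` vanishes on `[0, ℓ/2]`). [folklore] -/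
theorem bandPrim_eq_integral_of_le (hℓ : 0 < ℓ) (r : ℝ) :
    bandPrim κ ℓ r = ∫ v in (ℓ / 2)..r, bandRateW κ ℓ v := by
  have hint : ∀ a b : ℝ, IntervalIntegrable (bandRateW κ ℓ) volume a b := fun a b ↦
    continuous_bandRateW.intervalIntegrable a b
  rw [bandPrim, ← integral_add_adjacent_intervals (hint 0 (ℓ / 2)) (hint (ℓ / 2) r)]
  have h0 : (∫ v in (0 : ℝ)..(ℓ / 2), bandRateW κ ℓ v) = 0 := by
    have := bandPrim_eq_zero (κ := κ) hℓ (by positivity : (0 : ℝ) ≤ ℓ / 2) le_rfl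
    rwa [bandPrim] at this
  rw [h0, zero_add]

/-- `k` is continuous. [folklore] -/
theorem continuous_occKernel : Continuous (occKernel κ ℓ) :=
  ((continuous_const.add (continuous_id.pow 2)).rpow_const
    fun v ↦ Or.inl (one_add_sq_pos_slope v).ne').mul continuous_bandPrim

/-- `k` is odd. [folklore] -/
theorem occKernel_neg (r : ℝ) : occKernel κ ℓ (-r) = -occKernel κ ℓ r := by
  rw [occKernel, occKernel, bandPrim_neg, neg_sq, mul_neg]

/-- `k ≥ 0` on `[0, ∞)`. [folklore] -/
theorem occKernel_nonneg {r : ℝ} (hr : 0 ≤ r) : 0 ≤ occKernel κ ℓ r :=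
  mul_nonneg (Real.rpow_nonneg (one_add_sq_pos_slope r).le _) (bandPrim_nonneg hr)

/-- `k = 0` on `[0, ℓ/2]` (`ℓ > 0`). [folklore] -/
theorem occKernel_eq_zero (hℓ : 0 < ℓ) {r : ℝ} (hr0 : 0 ≤ r) (hr : r ≤ ℓ / 2) : occKernel κ ℓ r = 0 := by
  rw [occKernel, bandPrim_eq_zero hℓ hr0 hr, mul_zero]

/-- **`k' = -(8r/(κ(1+r²))) k + g_ℓ`** (product rule, `((1+r²)^{-4/κ})' = -(8r/κ)(1+r²)^{-4/κ-1}`,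
`(1+r²)^{-4/κ} g̃ = g`). [folklore] -/
theorem hasDerivAt_occKernel (hκ : 0 < κ) (r : ℝ) :
    HasDerivAt (occKernel κ ℓ) (occKernelDeriv κ ℓ r) r := by
  have hκ0 : (κ : ℝ) ≠ 0 := by exact_mod_cast hκ.ne'
  have hpos := one_add_sq_pos_slope r
  have h1 : HasDerivAt (fun r : ℝ ↦ 1 + r ^ 2) (2 * r) r := by
    have := ((hasDerivAt_id r).pow 2).const_add 1
    simpa using this
  have h2 : HasDerivAt (fun r : ℝ ↦ (1 + r ^ 2) ^ (-(4 : ℝ) / κ))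
      (2 * r * (-(4 : ℝ) / κ) * (1 + r ^ 2) ^ (-(4 : ℝ) / κ - 1)) r :=
    h1.rpow_const (Or.inl hpos.ne')
  have h3 := h2.mul (hasDerivAt_bandPrim (κ := κ) (ℓ := ℓ) r)
  have heq : 2 * r * (-(4 : ℝ) / κ) * (1 + r ^ 2) ^ (-(4 : ℝ) / κ - 1) * bandPrim κ ℓ r +
      (1 + r ^ 2) ^ (-(4 : ℝ) / κ) * bandRateW κ ℓ r = occKernelDeriv κ ℓ r := by
    rw [occKernelDeriv, occKernel, bandRateW, Real.rpow_sub_one hpos.ne']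
    have h4 : (1 + r ^ 2) ^ (-(4 : ℝ) / κ) * (bandRate ℓ r * (1 + r ^ 2) ^ ((4 : ℝ) / κ)) =
        bandRate ℓ r := by
      rw [mul_comm, mul_assoc, neg_div, Real.rpow_neg hpos.le, mul_inv_cancel₀
        (Real.rpow_pos_of_pos hpos _).ne', mul_one]
    rw [h4]
    field_simp
    ring
  rw [← heq]
  exact h3

/-- `k'` is continuous. [folklore] -/
theorem continuous_occKernelDeriv (hκ : 0 < κ) : Continuous (occKernelDeriv κ ℓ) := by
  have hκ0 : (κ : ℝ) ≠ 0 := by exact_mod_cast hκ.ne'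
  unfold occKernelDeriv
  refine ((Continuous.div ?_ ?_ ?_).neg.mul continuous_occKernel).add (continuous_bandRate ℓ)
  · exact continuous_const.mul continuous_id
  · exact continuous_const.mul (continuous_const.add (continuous_id.pow 2))
  · intro r; exact mul_ne_zero hκ0 (one_add_sq_pos_slope r).ne'

/-- `deriv k = k'`. [folklore] -/
theorem deriv_occKernel (hκ : 0 < κ) : deriv (occKernel κ ℓ) = occKernelDeriv κ ℓ :=
  funext fun r ↦ (hasDerivAt_occKernel hκ r).deriv

/-- `k ∈ C¹`. [folklore] -/
theorem contDiff_one_occKernel (hκ : 0 < κ) : ContDiff ℝ 1 (occKernel κ ℓ) := by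
  rw [contDiff_one_iff_deriv, deriv_occKernel hκ]
  exact ⟨fun r ↦ (hasDerivAt_occKernel hκ r).differentiableAt, continuous_occKernelDeriv hκ⟩

end Kernel

/-! ### Integrability and the decay `∫₀^∞ k ≤ 4 (1/κ + 1/(8-κ))⁻¹ … ≤ C/ℓ²` -/

section Decay

variable {κ : ℝ≥0} {ℓ : ℝ}

/-- `∫_{ℓ/2}^r v^{-2} dv ≤ 2/ℓ` for `ℓ/2 ≤ r`, `ℓ > 0`. [folklore] -/
theorem integral_rpow_neg_two_le (hℓ : 0 < ℓ) {r : ℝ} (hr : ℓ / 2 ≤ r) :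
    ∫ v in (ℓ / 2)..r, v ^ (-2 : ℝ) ≤ 2 / ℓ := by
  have hl2 : 0 < ℓ / 2 := by positivity
  have h0 : (0 : ℝ) ∉ uIcc (ℓ / 2) r := by
    rw [uIcc_of_le hr]; exact fun h ↦ absurd h.1 (not_le.2 hl2)
  rw [integral_rpow (Or.inr ⟨by norm_num, h0⟩)]
  have hr0 : 0 < r := hl2.trans_le hr
  have h1 : r ^ ((-2 : ℝ) + 1) = r⁻¹ := by norm_num [Real.rpow_neg_one]
  have h2 : (ℓ / 2) ^ ((-2 : ℝ) + 1) = (ℓ / 2)⁻¹ := by norm_num [Real.rpow_neg_one]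
  rw [h1, h2]
  have : (r⁻¹ - (ℓ / 2)⁻¹) / (-2 + 1) = 2 / ℓ - r⁻¹ := by
    field_simp; ring
  rw [this]
  linarith [inv_pos.2 hr0]

/-- `(1+v²)^{-1} ≤ v^{-2}` for `v > 0`. [folklore] -/
theorem one_add_sq_rpow_neg_one_le {v : ℝ} (hv : 0 < v) : (1 + v ^ 2) ^ (-1 : ℝ) ≤ v ^ (-2 : ℝ) := by
  rw [Real.rpow_neg_one, show (-2 : ℝ) = -(2 : ℝ) by norm_num, Real.rpow_neg hv.le,
    Real.rpow_two]
  exact inv_anti₀ (by positivity) (by linarith)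

/-- **The bound on `G` for `κ ≤ 4`**: `G(r) ≤ (8/ℓ)(1+r²)^{4/κ-1}` for `r ≥ ℓ/2`, `ℓ > 0`
(`g̃ ≤ 4(1+v²)^{4/κ-1}(1+v²)^{-1} ≤ 4(1+r²)^{4/κ-1} v^{-2}` for `v ≤ r`, as `4/κ - 1 ≥ 0`).
[folklore] -/
theorem bandPrim_le_of_le_four (hκ : 0 < κ) (hκ4 : κ ≤ 4) (hℓ : 0 < ℓ) {r : ℝ} (hr : ℓ / 2 ≤ r) :
    bandPrim κ ℓ r ≤ 8 / ℓ * (1 + r ^ 2) ^ ((4 : ℝ) / κ - 1) := by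
  have hl2 : 0 < ℓ / 2 := by positivity
  have he : 0 ≤ (4 : ℝ) / κ - 1 := by
    rw [sub_nonneg, le_div_iff₀ (by exact_mod_cast hκ)]
    have : (κ : ℝ) ≤ 4 := by exact_mod_cast hκ4
    linarith
  rw [bandPrim_eq_integral_of_le hℓ r]
  have hbound : ∀ v ∈ Icc (ℓ / 2) r, bandRateW κ ℓ v ≤
      4 * (1 + r ^ 2) ^ ((4 : ℝ) / κ - 1) * v ^ (-2 : ℝ) := by
    intro v hv
    have hv0 : 0 < v := hl2.trans_le hv.1
    refine (bandRateW_le v).trans ?_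
    have hsplit : (1 + v ^ 2) ^ ((4 : ℝ) / κ - 2) =
        (1 + v ^ 2) ^ ((4 : ℝ) / κ - 1) * (1 + v ^ 2) ^ (-1 : ℝ) := by
      rw [← Real.rpow_add (one_add_sq_pos_slope v)]; congr 1; ring
    rw [hsplit, ← mul_assoc]
    refine mul_le_mul ?_ (one_add_sq_rpow_neg_one_le hv0) (Real.rpow_nonneg (one_add_sq_pos_slope v).le _)
      (by positivity)
    refine mul_le_mul_of_nonneg_left ?_ (by norm_num)
    exact Real.rpow_le_rpow (one_add_sq_pos_slope v).le (by nlinarith [hv.2, hv0]) he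
  have hint1 : IntervalIntegrable (bandRateW κ ℓ) volume (ℓ / 2) r :=
    continuous_bandRateW.intervalIntegrable _ _
  have hint2 : IntervalIntegrable (fun v : ℝ ↦ 4 * (1 + r ^ 2) ^ ((4 : ℝ) / κ - 1) * v ^ (-2 : ℝ))
      volume (ℓ / 2) r := by
    refine (ContinuousOn.intervalIntegrable ?_)
    rw [uIcc_of_le hr]
    refine continuousOn_const.mul (ContinuousOn.rpow_const continuousOn_id fun v hv ↦ ?_)
    exact Or.inl (hl2.trans_le hv.1).ne'
  calc (∫ v in (ℓ / 2)..r, bandRateW κ ℓ v)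
      ≤ ∫ v in (ℓ / 2)..r, 4 * (1 + r ^ 2) ^ ((4 : ℝ) / κ - 1) * v ^ (-2 : ℝ) :=
        intervalIntegral.integral_mono_on hr hint1 hint2 hbound
    _ = 4 * (1 + r ^ 2) ^ ((4 : ℝ) / κ - 1) * ∫ v in (ℓ / 2)..r, v ^ (-2 : ℝ) := by
        rw [intervalIntegral.integral_const_mul]
    _ ≤ 4 * (1 + r ^ 2) ^ ((4 : ℝ) / κ - 1) * (2 / ℓ) :=
        mul_le_mul_of_nonneg_left (integral_rpow_neg_two_le hℓ hr) (by positivity)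
    _ = 8 / ℓ * (1 + r ^ 2) ^ ((4 : ℝ) / κ - 1) := by ring

/-- **The bound on `G` for `κ > 4`**: `G(r) ≤ (8/ℓ)(1+(ℓ/2)²)^{4/κ-1}` for `r ≥ ℓ/2`, `ℓ > 0`
(now `4/κ - 1 < 0`, so `(1+v²)^{4/κ-1} ≤ (1+(ℓ/2)²)^{4/κ-1}` for `v ≥ ℓ/2`). [folklore] -/
theorem bandPrim_le_of_four_lt (hκ4 : 4 < κ) (hℓ : 0 < ℓ) {r : ℝ} (hr : ℓ / 2 ≤ r) :
    bandPrim κ ℓ r ≤ 8 / ℓ * (1 + (ℓ / 2) ^ 2) ^ ((4 : ℝ) / κ - 1) := by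
  have hl2 : 0 < ℓ / 2 := by positivity
  have h4' : (4 : ℝ) < κ := by exact_mod_cast hκ4
  have hκ0 : (0 : ℝ) < κ := by linarith
  have he : (4 : ℝ) / κ - 1 ≤ 0 := by
    rw [sub_nonpos, div_le_iff₀ hκ0]
    linarith
  rw [bandPrim_eq_integral_of_le hℓ r]
  have hbound : ∀ v ∈ Icc (ℓ / 2) r, bandRateW κ ℓ v ≤
      4 * (1 + (ℓ / 2) ^ 2) ^ ((4 : ℝ) / κ - 1) * v ^ (-2 : ℝ) := by
    intro v hv
    have hv0 : 0 < v := hl2.trans_le hv.1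
    refine (bandRateW_le v).trans ?_
    have hsplit : (1 + v ^ 2) ^ ((4 : ℝ) / κ - 2) =
        (1 + v ^ 2) ^ ((4 : ℝ) / κ - 1) * (1 + v ^ 2) ^ (-1 : ℝ) := by
      rw [← Real.rpow_add (one_add_sq_pos_slope v)]; congr 1; ring
    rw [hsplit, ← mul_assoc]
    refine mul_le_mul ?_ (one_add_sq_rpow_neg_one_le hv0) (Real.rpow_nonneg (one_add_sq_pos_slope v).le _)
      (by positivity)
    refine mul_le_mul_of_nonneg_left ?_ (by norm_num)
    exact Real.rpow_le_rpow_of_nonpos (one_add_sq_pos_slope _) (by nlinarith [hv.1, hl2]) he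
  have hint1 : IntervalIntegrable (bandRateW κ ℓ) volume (ℓ / 2) r :=
    continuous_bandRateW.intervalIntegrable _ _
  have hint2 : IntervalIntegrable (fun v : ℝ ↦ 4 * (1 + (ℓ / 2) ^ 2) ^ ((4 : ℝ) / κ - 1) * v ^ (-2 : ℝ))
      volume (ℓ / 2) r := by
    refine (ContinuousOn.intervalIntegrable ?_)
    rw [uIcc_of_le hr]
    refine continuousOn_const.mul (ContinuousOn.rpow_const continuousOn_id fun v hv ↦ ?_)
    exact Or.inl (hl2.trans_le hv.1).ne'
  calc (∫ v in (ℓ / 2)..r, bandRateW κ ℓ v)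
      ≤ ∫ v in (ℓ / 2)..r, 4 * (1 + (ℓ / 2) ^ 2) ^ ((4 : ℝ) / κ - 1) * v ^ (-2 : ℝ) :=
        intervalIntegral.integral_mono_on hr hint1 hint2 hbound
    _ = 4 * (1 + (ℓ / 2) ^ 2) ^ ((4 : ℝ) / κ - 1) * ∫ v in (ℓ / 2)..r, v ^ (-2 : ℝ) := by
        rw [intervalIntegral.integral_const_mul]
    _ ≤ 4 * (1 + (ℓ / 2) ^ 2) ^ ((4 : ℝ) / κ - 1) * (2 / ℓ) :=
        mul_le_mul_of_nonneg_left (integral_rpow_neg_two_le hℓ hr) (by positivity)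
    _ = 8 / ℓ * (1 + (ℓ / 2) ^ 2) ^ ((4 : ℝ) / κ - 1) := by ring

variable (κ ℓ) in
/-- The integrable majorant of `k` on `[ℓ/2, ∞)`: `(8/ℓ) r^{-2}` if `κ ≤ 4`,
`(8/ℓ)(1+(ℓ/2)²)^{4/κ-1} r^{-8/κ}` if `κ > 4`. [folklore] -/
def occMajorant (r : ℝ) : ℝ :=
  if κ ≤ 4 then 8 / ℓ * r ^ (-2 : ℝ)
  else 8 / ℓ * (1 + (ℓ / 2) ^ 2) ^ ((4 : ℝ) / κ - 1) * r ^ (-(8 : ℝ) / κ)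

/-- **`k ≤` the majorant on `[ℓ/2, ∞)`** (`0 < κ < 8`, `ℓ > 0`). [folklore] -/
theorem occKernel_le_occMajorant (hκ : 0 < κ) (hℓ : 0 < ℓ) {r : ℝ} (hr : ℓ / 2 ≤ r) :
    occKernel κ ℓ r ≤ occMajorant κ ℓ r := by
  have hl2 : 0 < ℓ / 2 := by positivity
  have hr0 : 0 < r := hl2.trans_le hr
  have hpos := one_add_sq_pos_slope r
  rw [occMajorant, occKernel]
  split_ifs with h4
  · calc (1 + r ^ 2) ^ (-(4 : ℝ) / κ) * bandPrim κ ℓ r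
        ≤ (1 + r ^ 2) ^ (-(4 : ℝ) / κ) * (8 / ℓ * (1 + r ^ 2) ^ ((4 : ℝ) / κ - 1)) :=
          mul_le_mul_of_nonneg_left (bandPrim_le_of_le_four hκ h4 hℓ hr) (Real.rpow_nonneg hpos.le _)
      _ = 8 / ℓ * (1 + r ^ 2) ^ (-1 : ℝ) := by
          rw [mul_left_comm, ← Real.rpow_add hpos]
          congr 2; ring
      _ ≤ 8 / ℓ * r ^ (-2 : ℝ) :=
          mul_le_mul_of_nonneg_left (one_add_sq_rpow_neg_one_le hr0) (by positivity)
  · rw [not_le] at h4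
    calc (1 + r ^ 2) ^ (-(4 : ℝ) / κ) * bandPrim κ ℓ r
        ≤ (1 + r ^ 2) ^ (-(4 : ℝ) / κ) * (8 / ℓ * (1 + (ℓ / 2) ^ 2) ^ ((4 : ℝ) / κ - 1)) :=
          mul_le_mul_of_nonneg_left (bandPrim_le_of_four_lt h4 hℓ hr) (Real.rpow_nonneg hpos.le _)
      _ = 8 / ℓ * (1 + (ℓ / 2) ^ 2) ^ ((4 : ℝ) / κ - 1) * (1 + r ^ 2) ^ (-(4 : ℝ) / κ) := by ring
      _ ≤ 8 / ℓ * (1 + (ℓ / 2) ^ 2) ^ ((4 : ℝ) / κ - 1) * r ^ (-(8 : ℝ) / κ) := by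
          refine mul_le_mul_of_nonneg_left ?_ (by positivity)
          have h1 : r ^ (-(8 : ℝ) / κ) = (r ^ 2) ^ (-(4 : ℝ) / κ) := by
            rw [← Real.rpow_natCast r 2, ← Real.rpow_mul hr0.le]
            congr 1; push_cast; ring
          rw [h1]
          exact Real.rpow_le_rpow_of_nonpos (by positivity) (by linarith)
            (div_nonpos_of_nonpos_of_nonneg (by norm_num) κ.coe_nonneg)

/-- The majorant is integrable on `(ℓ/2, ∞)` (`0 < κ < 8`, `ℓ > 0`). [folklore] -/
theorem integrableOn_occMajorant (hκ8 : κ < 8) (hℓ : 0 < ℓ) :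
    IntegrableOn (occMajorant κ ℓ) (Ioi (ℓ / 2)) := by
  have hl2 : 0 < ℓ / 2 := by positivity
  unfold occMajorant
  split_ifs with h4
  · exact ((integrableOn_Ioi_rpow_of_lt (by norm_num) hl2).const_mul _)
  · rw [not_le] at h4
    have h4' : (4 : ℝ) < κ := by exact_mod_cast h4
    have hκ0 : (0 : ℝ) < κ := by linarith
    have hκ8' : (κ : ℝ) < 8 := by exact_mod_cast hκ8
    have hlt : -(8 : ℝ) / κ < -1 := by
      rw [div_lt_iff₀ hκ0]; linarith
    exact ((integrableOn_Ioi_rpow_of_lt hlt hl2).const_mul _)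

/-- The integral of the majorant: `∫_{ℓ/2}^∞ occMajorant ≤ (16/κ' )/ℓ²` with the two-regime
constant, precisely `≤ (16 + 16 κ/(8-κ)) / ℓ²`. [folklore] -/
theorem integral_occMajorant_le (hκ8 : κ < 8) (hℓ : 0 < ℓ) :
    ∫ r in Ioi (ℓ / 2), occMajorant κ ℓ r ≤ (16 + 16 * κ / (8 - κ)) / ℓ ^ 2 := by
  have hl2 : 0 < ℓ / 2 := by positivity
  have hκ8' : (κ : ℝ) < 8 := by exact_mod_cast hκ8
  have h8 : (0 : ℝ) < 8 - κ := by linarith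
  have hextra : (0 : ℝ) ≤ 16 * κ / (8 - κ) := by positivity
  unfold occMajorant
  split_ifs with h4
  · rw [MeasureTheory.integral_const_mul, integral_Ioi_rpow_of_lt (by norm_num) hl2]
    have h1 : (ℓ / 2) ^ ((-2 : ℝ) + 1) = (ℓ / 2)⁻¹ := by norm_num [Real.rpow_neg_one]
    rw [h1]
    have : 8 / ℓ * (-(ℓ / 2)⁻¹ / (-2 + 1)) = 16 / ℓ ^ 2 := by
      field_simp; ring
    rw [this, div_le_div_iff_of_pos_right (by positivity)]
    linarith
  · rw [not_le] at h4
    have hκ4 : (4 : ℝ) < κ := by exact_mod_cast h4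
    have hκ0 : (0 : ℝ) < κ := by linarith
    have hlt : -(8 : ℝ) / κ < -1 := by rw [div_lt_iff₀ hκ0]; linarith
    have hne : -(8 : ℝ) / κ + 1 ≠ 0 := by
      intro h; rw [div_add_one hκ0.ne', div_eq_zero_iff] at h
      rcases h with h | h <;> linarith
    rw [MeasureTheory.integral_const_mul, integral_Ioi_rpow_of_lt hlt hl2]
    -- `(1 + (ℓ/2)²)^{4/κ-1} ≤ ((ℓ/2)²)^{4/κ-1} = (ℓ/2)^{8/κ-2}`
    have he : (4 : ℝ) / κ - 1 ≤ 0 := by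
      rw [sub_nonpos, div_le_iff₀ hκ0]; linarith
    have hA : (1 + (ℓ / 2) ^ 2) ^ ((4 : ℝ) / κ - 1) ≤ (ℓ / 2) ^ ((8 : ℝ) / κ - 2) := by
      have h1 : (ℓ / 2) ^ ((8 : ℝ) / κ - 2) = ((ℓ / 2) ^ 2) ^ ((4 : ℝ) / κ - 1) := by
        rw [← Real.rpow_natCast (ℓ / 2) 2, ← Real.rpow_mul hl2.le]
        congr 1; push_cast; ring
      rw [h1]
      exact Real.rpow_le_rpow_of_nonpos (by positivity) (by linarith) he
    have hB : 0 ≤ -(ℓ / 2) ^ (-(8 : ℝ) / κ + 1) / (-(8 : ℝ) / κ + 1) := by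
      rw [neg_div, ← div_neg]
      refine div_nonneg (Real.rpow_nonneg hl2.le _) ?_
      rw [neg_add', sub_nonneg, neg_div, neg_neg, le_div_iff₀ hκ0]; linarith
    calc 8 / ℓ * (1 + (ℓ / 2) ^ 2) ^ ((4 : ℝ) / κ - 1) *
          (-(ℓ / 2) ^ (-(8 : ℝ) / κ + 1) / (-(8 : ℝ) / κ + 1))
        ≤ 8 / ℓ * (ℓ / 2) ^ ((8 : ℝ) / κ - 2) *
          (-(ℓ / 2) ^ (-(8 : ℝ) / κ + 1) / (-(8 : ℝ) / κ + 1)) :=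
          mul_le_mul_of_nonneg_right (mul_le_mul_of_nonneg_left hA (by positivity)) hB
      _ = 16 * κ / (8 - κ) / ℓ ^ 2 := by
          have hprod : (ℓ / 2) ^ ((8 : ℝ) / κ - 2) * (ℓ / 2) ^ (-(8 : ℝ) / κ + 1) = (ℓ / 2)⁻¹ := by
            rw [← Real.rpow_add hl2, ← Real.rpow_neg_one]
            congr 1; ring
          calc 8 / ℓ * (ℓ / 2) ^ ((8 : ℝ) / κ - 2) * (-(ℓ / 2) ^ (-(8 : ℝ) / κ + 1) / (-(8 : ℝ) / κ + 1))
              = 8 / ℓ * ((ℓ / 2) ^ ((8 : ℝ) / κ - 2) * (ℓ / 2) ^ (-(8 : ℝ) / κ + 1)) *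
                  (-1 / (-(8 : ℝ) / κ + 1)) := by ring
            _ = 8 / ℓ * (ℓ / 2)⁻¹ * (-1 / (-(8 : ℝ) / κ + 1)) := by rw [hprod]
            _ = 16 * κ / (8 - κ) / ℓ ^ 2 := by
                have e1 : (-(8 : ℝ) / κ + 1) = -((8 - κ) / κ) := by
                  field_simp
                  ring
                rw [e1]
                field_simp [hκ0.ne', h8.ne', hℓ.ne']
                ring
      _ ≤ (16 + 16 * κ / (8 - κ)) / ℓ ^ 2 := by
          rw [div_le_div_iff_of_pos_right (by positivity)]
          linarith

/-- **`k` is integrable on `(0, ∞)`** (`0 < κ < 8`, `ℓ > 0`): it vanishes on `(0, ℓ/2]` and is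
dominated by the integrable majorant on `(ℓ/2, ∞)`. [folklore] -/
theorem integrableOn_occKernel_Ioi (hκ : 0 < κ) (hκ8 : κ < 8) (hℓ : 0 < ℓ) :
    IntegrableOn (occKernel κ ℓ) (Ioi 0) := by
  have hl2 : 0 < ℓ / 2 := by positivity
  have hsplit : Ioi (0 : ℝ) = Ioc 0 (ℓ / 2) ∪ Ioi (ℓ / 2) := (Ioc_union_Ioi_eq_Ioi hl2.le).symm
  rw [hsplit]
  refine IntegrableOn.union ?_ ?_
  · exact (continuous_occKernel.continuousOn.integrableOn_compact isCompact_Icc).mono_set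
      Ioc_subset_Icc_self
  · refine Integrable.mono' (integrableOn_occMajorant hκ8 hℓ)
      continuous_occKernel.aestronglyMeasurable ?_
    refine (ae_restrict_mem measurableSet_Ioi).mono fun r hr ↦ ?_
    rw [Real.norm_eq_abs, abs_of_nonneg (occKernel_nonneg (hl2.trans hr).le)]
    exact occKernel_le_occMajorant hκ hℓ hr.le

/-- **`∫₀^∞ k ≤ (16 + 16κ/(8-κ))/ℓ²`** (`0 < κ < 8`, `ℓ > 0`). [folklore] -/
theorem integral_occKernel_Ioi_le (hκ : 0 < κ) (hκ8 : κ < 8) (hℓ : 0 < ℓ) :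
    ∫ r in Ioi 0, occKernel κ ℓ r ≤ (16 + 16 * κ / (8 - κ)) / ℓ ^ 2 := by
  have hl2 : 0 < ℓ / 2 := by positivity
  have hint := integrableOn_occKernel_Ioi hκ hκ8 hℓ
  have h0 : (∫ r in Ioi 0, occKernel κ ℓ r) = ∫ r in Ioi (ℓ / 2), occKernel κ ℓ r := by
    have h1 := integral_Ioi_sub_Ioi hint hl2.le
    have h2 : (∫ r in (0 : ℝ)..(ℓ / 2), occKernel κ ℓ r) = 0 :=
      intervalIntegral.integral_zero_ae (ae_of_all _ fun r hr ↦ by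
        rw [uIoc_of_le hl2.le] at hr
        exact occKernel_eq_zero hℓ hr.1.le hr.2)
    rw [h2, sub_eq_zero] at h1
    exact h1
  rw [h0]
  refine (setIntegral_mono_on (hint.mono_set (Ioi_subset_Ioi hl2.le)) (integrableOn_occMajorant hκ8 hℓ)
    measurableSet_Ioi fun r hr ↦ occKernel_le_occMajorant hκ hℓ hr.le).trans ?_
  exact integral_occMajorant_le hκ8 hℓ

/-- `∫₀^∞ k ≥ 0`. [folklore] -/
theorem integral_occKernel_Ioi_nonneg : 0 ≤ ∫ r in Ioi 0, occKernel κ ℓ r :=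
  setIntegral_nonneg measurableSet_Ioi fun _ hr ↦ occKernel_nonneg (le_of_lt hr)

end Decay

/-! ### The function `U_ℓ` -/

section OccFn

variable (κ : ℝ≥0) (ℓ : ℝ)

/-- **The decay constant `C_κ = 64/κ + 64/(8-κ)`** of `Ū_ℓ ≤ C_κ/ℓ²`. [folklore] -/
def occConst : ℝ := 64 / κ + 64 / (8 - κ)

/-- **`Ū_ℓ = (4/κ) ∫₀^∞ k`**, the supremum of `U_ℓ`. [folklore] -/
def occSup : ℝ := 4 / κ * ∫ r in Ioi 0, occKernel κ ℓ r

/-- **`U_ℓ(w) = Ū_ℓ - (4/κ) ∫₀ʷ k`**: the even, non-negative, bounded `C²` solution of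
`A U = -2 g_ℓ` vanishing at `±∞`. [folklore] -/
def occFn (w : ℝ) : ℝ := occSup κ ℓ - 4 / κ * ∫ r in (0 : ℝ)..w, occKernel κ ℓ r

variable {κ ℓ}

/-- `C_κ > 0` for `0 < κ < 8`. [folklore] -/
theorem occConst_pos (hκ : 0 < κ) (hκ8 : κ < 8) : 0 < occConst κ := by
  have hκ0 : (0 : ℝ) < κ := by exact_mod_cast hκ
  have hκ8' : (κ : ℝ) < 8 := by exact_mod_cast hκ8
  unfold occConst
  have : (0 : ℝ) < 8 - κ := by linarith
  positivity

/-- **`Ū_ℓ ≤ C_κ / ℓ²`** (`0 < κ < 8`, `ℓ > 0`). [folklore] -/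
theorem occSup_le (hκ : 0 < κ) (hκ8 : κ < 8) (hℓ : 0 < ℓ) : occSup κ ℓ ≤ occConst κ / ℓ ^ 2 := by
  have hκ0 : (0 : ℝ) < κ := by exact_mod_cast hκ
  have hκ8' : (κ : ℝ) < 8 := by exact_mod_cast hκ8
  have h8 : (0 : ℝ) < 8 - κ := by linarith
  unfold occSup occConst
  calc 4 / κ * ∫ r in Ioi 0, occKernel κ ℓ r ≤ 4 / κ * ((16 + 16 * κ / (8 - κ)) / ℓ ^ 2) :=
        mul_le_mul_of_nonneg_left (integral_occKernel_Ioi_le hκ hκ8 hℓ) (by positivity)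
    _ = (64 / κ + 64 / (8 - κ)) / ℓ ^ 2 := by
        field_simp
        ring

/-- `Ū_ℓ ≥ 0`. [folklore] -/
theorem occSup_nonneg : 0 ≤ occSup κ ℓ :=
  mul_nonneg (div_nonneg (by norm_num) κ.coe_nonneg) integral_occKernel_Ioi_nonneg

/-- `∫₀ʷ k = ∫₀^{|w|} k` (`k` is odd). [folklore] -/
theorem integral_occKernel_eq_abs (w : ℝ) :
    ∫ r in (0 : ℝ)..w, occKernel κ ℓ r = ∫ r in (0 : ℝ)..|w|, occKernel κ ℓ r := by
  rcases le_or_gt 0 w with hw | hw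
  · rw [abs_of_nonneg hw]
  · rw [abs_of_neg hw]
    have h1 : (∫ r in (0 : ℝ)..w, occKernel κ ℓ r) = ∫ r in (0 : ℝ)..w, -occKernel κ ℓ (-r) := by
      refine integral_congr fun r _ ↦ ?_
      rw [occKernel_neg, neg_neg]
    rw [h1, intervalIntegral.integral_neg, intervalIntegral.integral_comp_neg, neg_zero,
      integral_symm, neg_neg]

/-- `0 ≤ ∫₀ʷ k` for every `w`. [folklore] -/
theorem integral_occKernel_nonneg (w : ℝ) : 0 ≤ ∫ r in (0 : ℝ)..w, occKernel κ ℓ r := by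
  rw [integral_occKernel_eq_abs]
  exact intervalIntegral.integral_nonneg (abs_nonneg w) fun r hr ↦ occKernel_nonneg hr.1

/-- `∫₀ʷ k ≤ ∫₀^∞ k` for every `w` (`0 < κ < 8`, `ℓ > 0`). [folklore] -/
theorem integral_occKernel_le_Ioi (hκ : 0 < κ) (hκ8 : κ < 8) (hℓ : 0 < ℓ) (w : ℝ) :
    ∫ r in (0 : ℝ)..w, occKernel κ ℓ r ≤ ∫ r in Ioi 0, occKernel κ ℓ r := by
  rw [integral_occKernel_eq_abs]
  have hint := integrableOn_occKernel_Ioi hκ hκ8 hℓ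
  have h1 := integral_Ioi_sub_Ioi hint (abs_nonneg w)
  have h2 : 0 ≤ ∫ r in Ioi |w|, occKernel κ ℓ r :=
    setIntegral_nonneg measurableSet_Ioi fun r hr ↦ occKernel_nonneg ((abs_nonneg w).trans (le_of_lt hr))
  linarith

/-- **`0 ≤ U_ℓ`** (`0 < κ < 8`, `ℓ > 0`). [folklore] -/
theorem occFn_nonneg (hκ : 0 < κ) (hκ8 : κ < 8) (hℓ : 0 < ℓ) (w : ℝ) : 0 ≤ occFn κ ℓ w := by
  unfold occFn occSup
  rw [← mul_sub]
  exact mul_nonneg (div_nonneg (by norm_num) κ.coe_nonneg)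
    (sub_nonneg.2 (integral_occKernel_le_Ioi hκ hκ8 hℓ w))

/-- **`U_ℓ ≤ Ū_ℓ`**. [folklore] -/
theorem occFn_le_occSup (w : ℝ) : occFn κ ℓ w ≤ occSup κ ℓ := by
  unfold occFn
  have := mul_nonneg (div_nonneg (by norm_num : (0 : ℝ) ≤ 4) κ.coe_nonneg) (integral_occKernel_nonneg (κ := κ) (ℓ := ℓ) w)
  linarith

/-- **`U_ℓ' = -(4/κ) k`** (fundamental theorem of calculus). [folklore] -/
theorem hasDerivAt_occFn (w : ℝ) : HasDerivAt (occFn κ ℓ) (-(4 / κ) * occKernel κ ℓ w) w := by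
  have h1 : HasDerivAt (fun w ↦ ∫ r in (0 : ℝ)..w, occKernel κ ℓ r) (occKernel κ ℓ w) w :=
    (continuous_occKernel.integral_hasStrictDerivAt 0 w).hasDerivAt
  have h2 : HasDerivAt (occFn κ ℓ) (-(4 / (κ : ℝ) * occKernel κ ℓ w)) w :=
    (h1.const_mul (4 / (κ : ℝ))).const_sub (occSup κ ℓ)
  rw [neg_mul]
  exact h2

/-- `deriv U_ℓ = -(4/κ) k`. [folklore] -/
theorem deriv_occFn : deriv (occFn κ ℓ) = fun w ↦ -(4 / κ) * occKernel κ ℓ w :=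
  funext fun w ↦ (hasDerivAt_occFn w).deriv

/-- `U_ℓ'' = -(4/κ) k'`. [folklore] -/
theorem iteratedDeriv_two_occFn (hκ : 0 < κ) (w : ℝ) :
    iteratedDeriv 2 (occFn κ ℓ) w = -(4 / κ) * occKernelDeriv κ ℓ w := by
  rw [iteratedDeriv_succ, iteratedDeriv_one, deriv_occFn]
  exact ((hasDerivAt_occKernel hκ w).const_mul _).deriv

/-- **`U_ℓ ∈ C²(ℝ)`**. [folklore] -/
theorem contDiff_two_occFn (hκ : 0 < κ) : ContDiff ℝ 2 (occFn κ ℓ) := by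
  rw [show (2 : WithTop ℕ∞) = 1 + 1 from rfl, contDiff_succ_iff_deriv, deriv_occFn]
  refine ⟨fun w ↦ (hasDerivAt_occFn w).differentiableAt, fun h ↦ ?_, ?_⟩
  · exact absurd h (by decide)
  · exact contDiff_const.mul (contDiff_one_occKernel hκ)

/-- **`A U_ℓ = -2 g_ℓ`**: `(κ/2) U'' + (4w/(1+w²)) U' = -2k' - (16w/(κ(1+w²))) k = -2 g_ℓ` by the
formula for `k'`. [folklore] -/
theorem slopeGen_occFn (hκ : 0 < κ) (w : ℝ) : slopeGen κ (occFn κ ℓ) w = -2 * bandRate ℓ w := by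
  have hκ0 : (κ : ℝ) ≠ 0 := by exact_mod_cast hκ.ne'
  have hpos := one_add_sq_pos_slope w
  rw [slopeGen_apply, iteratedDeriv_two_occFn hκ, deriv_occFn]
  simp only [occKernelDeriv]
  field_simp
  ring

end OccFn

/-! ### The supersolution `V = 1 + μ U` of `(A + μ g_ℓ) V ≤ 0` -/

section Super

variable (κ : ℝ≥0) (ℓ : ℝ)

/-- **The rate `μ_ℓ = ℓ²/C_κ`** (`≤ 1/Ū_ℓ`). [folklore] -/
def occRateConst : ℝ := ℓ ^ 2 / occConst κ

/-- **`V_ℓ = 1 + μ_ℓ U_ℓ`**, with `1 ≤ V_ℓ ≤ 2` and `(A + μ_ℓ g_ℓ) V_ℓ ≤ 0`. [folklore] -/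
def occSuper (w : ℝ) : ℝ := 1 + occRateConst κ ℓ * occFn κ ℓ w

variable {κ ℓ}

/-- `μ_ℓ > 0` (`0 < κ < 8`, `ℓ ≠ 0`). [folklore] -/
theorem occRateConst_pos (hκ : 0 < κ) (hκ8 : κ < 8) (hℓ : 0 < ℓ) : 0 < occRateConst κ ℓ :=
  div_pos (by positivity) (occConst_pos hκ hκ8)

/-- `μ_ℓ Ū_ℓ ≤ 1`. [folklore] -/
theorem occRateConst_mul_occSup_le (hκ : 0 < κ) (hκ8 : κ < 8) (hℓ : 0 < ℓ) :
    occRateConst κ ℓ * occSup κ ℓ ≤ 1 := by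
  have hC := occConst_pos hκ hκ8
  calc occRateConst κ ℓ * occSup κ ℓ ≤ occRateConst κ ℓ * (occConst κ / ℓ ^ 2) :=
        mul_le_mul_of_nonneg_left (occSup_le hκ hκ8 hℓ) (occRateConst_pos hκ hκ8 hℓ).le
    _ = 1 := by
        unfold occRateConst
        field_simp

/-- **`1 ≤ V_ℓ`**. [folklore] -/
theorem one_le_occSuper (hκ : 0 < κ) (hκ8 : κ < 8) (hℓ : 0 < ℓ) (w : ℝ) : 1 ≤ occSuper κ ℓ w := by
  unfold occSuper
  have := mul_nonneg (occRateConst_pos hκ hκ8 hℓ).le (occFn_nonneg hκ hκ8 hℓ w)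
  linarith

/-- **`V_ℓ ≤ 2`**. [folklore] -/
theorem occSuper_le_two (hκ : 0 < κ) (hκ8 : κ < 8) (hℓ : 0 < ℓ) (w : ℝ) : occSuper κ ℓ w ≤ 2 := by
  unfold occSuper
  have h1 : occRateConst κ ℓ * occFn κ ℓ w ≤ occRateConst κ ℓ * occSup κ ℓ :=
    mul_le_mul_of_nonneg_left (occFn_le_occSup w) (occRateConst_pos hκ hκ8 hℓ).le
  have h2 := occRateConst_mul_occSup_le hκ hκ8 hℓ
  linarith

/-- `V_ℓ ∈ C²(ℝ)`. [folklore] -/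
theorem contDiff_two_occSuper (hκ : 0 < κ) : ContDiff ℝ 2 (occSuper κ ℓ) :=
  contDiff_const.add (contDiff_const.mul (contDiff_two_occFn hκ))

/-- `A V_ℓ = -2 μ_ℓ g_ℓ`. [folklore] -/
theorem slopeGen_occSuper (hκ : 0 < κ) (w : ℝ) :
    slopeGen κ (occSuper κ ℓ) w = -2 * occRateConst κ ℓ * bandRate ℓ w := by
  have hd : ∀ v, HasDerivAt (occSuper κ ℓ) (occRateConst κ ℓ * (-(4 / κ) * occKernel κ ℓ v)) v :=
    fun v ↦ by
      unfold occSuper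
      exact ((hasDerivAt_occFn v).const_mul _).const_add 1
  have hd1 : deriv (occSuper κ ℓ) = fun v ↦ occRateConst κ ℓ * (-(4 / κ) * occKernel κ ℓ v) :=
    funext fun v ↦ (hd v).deriv
  have hd2 : iteratedDeriv 2 (occSuper κ ℓ) w =
      occRateConst κ ℓ * (-(4 / κ) * occKernelDeriv κ ℓ w) := by
    rw [iteratedDeriv_succ, iteratedDeriv_one, hd1]
    exact (((hasDerivAt_occKernel hκ w).const_mul _).const_mul _).deriv
  have h0 := slopeGen_occFn (ℓ := ℓ) hκ w
  rw [slopeGen_apply, iteratedDeriv_two_occFn hκ, deriv_occFn] at h0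
  rw [slopeGen_apply, hd2, hd1]
  simp only at h0 ⊢
  have : (κ : ℝ) / 2 * (occRateConst κ ℓ * (-(4 / ↑κ) * occKernelDeriv κ ℓ w)) +
      4 * w / (1 + w ^ 2) * (occRateConst κ ℓ * (-(4 / ↑κ) * occKernel κ ℓ w)) =
      occRateConst κ ℓ * ((κ : ℝ) / 2 * (-(4 / ↑κ) * occKernelDeriv κ ℓ w) +
        4 * w / (1 + w ^ 2) * (-(4 / ↑κ) * occKernel κ ℓ w)) := by ring
  rw [this, h0]
  ring

/-- **`(A + μ_ℓ g_ℓ θ) V_ℓ ≤ 0` for every `θ ∈ [0, 1]`** (the drift of the exponential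
supermartingale, the factor `θ` being an indicator in time):
`μ(-2g) + μ g θ (1 + μU) ≤ μ g (-2 + 2θ) ≤ 0`. [folklore] -/
theorem slopeGen_occSuper_add_le (hκ : 0 < κ) (hκ8 : κ < 8) (hℓ : 0 < ℓ) (w : ℝ) {θ : ℝ}
    (hθ0 : 0 ≤ θ) (hθ1 : θ ≤ 1) :
    slopeGen κ (occSuper κ ℓ) w + occSuper κ ℓ w * (occRateConst κ ℓ * bandRate ℓ w * θ) ≤ 0 := by
  rw [slopeGen_occSuper hκ]
  have hμ := (occRateConst_pos hκ hκ8 hℓ).le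
  have hg := bandRate_nonneg ℓ w
  have hV := occSuper_le_two hκ hκ8 hℓ w
  have hV1 := one_le_occSuper hκ hκ8 hℓ w
  have h1 : occSuper κ ℓ w * (occRateConst κ ℓ * bandRate ℓ w * θ) ≤
      2 * (occRateConst κ ℓ * bandRate ℓ w * 1) := by
    refine mul_le_mul hV ?_ (by positivity) (by norm_num)
    exact mul_le_mul_of_nonneg_left hθ1 (by positivity)
  nlinarith

end Super

end Literature.Probability.RandomPlanarGeometry
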